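import Summits.QuantumFields.YangMills.Theorems.AllWindowsColdBoxBoxHighLineTripleFormExpansion
import Summits.QuantumFields.YangMills.Theorems.AllWindowsColdBoxBoxHighLineCubeTwoCentreSums
import Summits.QuantumFields.YangMills.Theorems.AllWindowsColdBoxBoxHighLineCubeShellSums
import Summits.QuantumFields.YangMills.Theorems.AllWindowsColdBoxBoxHighLineLandauMinimiser

/-!
# T-S5.12a, part 2 — the TRIPLE-BOND estimate `E₀[(β Σ_p tripleForm T_p (plaqVar_p a))²] ≤ C·B²·H⁴(1+log H)³/β`

Planner ym-idea-2 g18's `TaskS5Step2Wick.lean` 12a `CubicVariance` / 10 `CubicDecorrelation`: the cubic vertex is (by 7a) `β Σ_p tripleForm T (plaqVar_p)` plus a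
quintic remainder; this file bounds the Gaussian second moment of the triple-product part for ANY bounded coefficients `|T_p ijk| ≤ B`:

* §1 plaquette geometry: the edges `plaqEdge x μ ν i` sit within sup-distance `1` of `x`, so cross propagators between the plaquettes at `x` and `y` decay
  like `(1 + d(x,y))⁻²` (`inv_sq_one_add_siteDist_le`, factor `9`);
* §2 the cross-propagator bound `cross_propagator_le` from ✓S3b (`coldBox_propagator_decay`): `|(2β)⁻¹[c=c']G_H(e,e')| ≤ (2β)⁻¹·9C(1+log H)/(1+d(y,x))²`;
* §3 the per-pair triple bond `abs_integral_plaqPair_le` (✓`abs_integral_tripleForm_mul_tripleForm_le`);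
* §4 counting: `sum_plaquettes_inv_pow_six_le` (`Σ_{p'∈S} (1+d(p'.1,x))⁻⁶ ≤ 2048` for ANY finite set of plaquettes, fibres of ✓`CubeShell.card_fibre_le`)
  and `card_plaquettesTouching_le` (`#plaquettesTouching(boxEdges 4 (2H+1)) ≤ 16(2H+2)⁴`, ✓`base_bounds_of_mem_plaquettesTouching`);
* §5 ★`tripleBond_gaussAvg_le` — `gaussAvg β H (fun a => (β · Σ_{p touching} tripleForm (T p) (plaqVar H p.1 p.2.1.1 p.2.1.2 a))²) ≤ C·B²·H⁴·(1+log H)³/β`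
  for all `H ≥ 1`, `β > 0` (the constant `C` depends only on ✓S3b's).

Tree (✓TripleFormExpansion, ✓CubeTwoCentreSums, ✓CubeShellSums, ✓LandauMinimiser) + Mathlib; no definitions.  HONEST LABEL: the triple-product half of 12a; the
quintic remainder (7a) and 12a/10 by name, T-S5.13/S5, U5, ⟨24004⟩ ⟨24335⟩ ⟨24336⟩ remain OPEN; route AllWindowsColdBox is DRAFT; no rung is proved; the Yang–Mills
mass gap is NOT proved by this file.  Seat ym-line-sfw-p2 g77 (LEAD, cell ym-idea-1; Wick layer T-S5.10/11/12a).
-/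

set_option autoImplicit false

noncomputable section

open MeasureTheory Matrix Finset
open scoped Kronecker Nat Matrix
open Literature.Probability.LatticeModels (Site)
open Literature.MathematicalPhysics.QuantumLattice (ZdPlaquette plaquettesTouching)

namespace Summit.QuantumFields.YangMills.Theorems.AllWindowsColdBoxBoxHighLine

namespace EdgeChartGaussian

open CubeTwoCentre (abs_sub_le_siteDist siteDist_le_of_forall)

/-! ## §1 Plaquette geometry -/

/-- The base site of each of the four edges of a plaquette is within sup-distance `1` of the plaquette's base point. -/
theorem plaqEdge_fst_sub_le (x : Site 4) (μ ν i k : Fin 4) : |(((plaqEdge x μ ν i).1 k - x k : ℤ) : ℝ)| ≤ 1 := by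
  fin_cases i <;> simp [plaqEdge, Pi.single_apply] <;> split_ifs <;> simp

/-- `siteDist` is symmetric. -/
theorem siteDist_comm (x y : Site 4) : siteDist x y = siteDist y x := by
  unfold siteDist
  congr 1; funext k
  rw [← abs_neg]; congr 1; push_cast; ring

/-- If `ex`, `ey` are within sup-distance `1` of `x`, `y` then `(1 + d(ex,ey))⁻² ≤ 9·(1 + d(x,y))⁻²`. -/
theorem inv_sq_one_add_siteDist_le (x y ex ey : Site 4) (hx : ∀ k, |((ex k - x k : ℤ) : ℝ)| ≤ 1) (hy : ∀ k, |((ey k - y k : ℤ) : ℝ)| ≤ 1) :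
    1 / (1 + siteDist ex ey) ^ 2 ≤ 9 / (1 + siteDist x y) ^ 2 := by
  have hd : siteDist x y ≤ siteDist ex ey + 2 := by
    refine siteDist_le_of_forall x y fun k => ?_
    have h1 := hx k
    have h2 := hy k
    have h3 := abs_sub_le_siteDist ex ey k
    have he : ((x k - y k : ℤ) : ℝ) = ((ex k - ey k : ℤ) : ℝ) - ((ex k - x k : ℤ) : ℝ) + ((ey k - y k : ℤ) : ℝ) := by
      push_cast; ring
    rw [he]
    calc _ ≤ |((ex k - ey k : ℤ) : ℝ) - ((ex k - x k : ℤ) : ℝ)| + |((ey k - y k : ℤ) : ℝ)| := abs_add_le _ _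
      _ ≤ |((ex k - ey k : ℤ) : ℝ)| + |((ex k - x k : ℤ) : ℝ)| + |((ey k - y k : ℤ) : ℝ)| := by
          gcongr; exact abs_sub _ _
      _ ≤ siteDist ex ey + 2 := by linarith
  have h0 : 0 ≤ siteDist ex ey := GhostKernel.siteDist_nonneg ex ey
  have h0' : 0 ≤ siteDist x y := GhostKernel.siteDist_nonneg x y
  rw [div_le_div_iff₀ (by positivity) (by positivity), one_mul]
  nlinarith [hd, h0, h0']

/-! ## §2 The cross propagator between two plaquettes (✓S3b) -/

/-- ★ There is `C ≥ 0` (✓S3b's constant) such that for `H ≥ 1`, `β > 0`, any two plaquettes based at `x`, `y` and free edges `e` on the first, `e'` on the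
second: `|(2β)⁻¹·[c=c']·G_H(e,e')| ≤ (2β)⁻¹ · 9C(1+log H)/(1+d(y,x))²`. -/
theorem cross_propagator_le : ∃ C : ℝ, 0 ≤ C ∧ ∀ H : ℕ, 1 ≤ H → ∀ β : ℝ, 0 < β →
    ∀ (x y : Site 4) (μ ν μ' ν' : Fin 4) (e e' : LandauFree H) (i i' : Fin 4),
      (e.1.1 : Literature.MathematicalPhysics.QuantumLattice.ZdEdge 4) = plaqEdge x μ ν i →
      (e'.1.1 : Literature.MathematicalPhysics.QuantumLattice.ZdEdge 4) = plaqEdge y μ' ν' i' →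
      ∀ c c' : Fin 3, |(2 * β)⁻¹ * (if c = c' then (hodgeQ H)⁻¹ e e' else 0)| ≤
        (2 * β)⁻¹ * (9 * C * (1 + Real.log H) / (1 + siteDist y x) ^ 2) := by
  obtain ⟨C, hC⟩ := coldBox_propagator_decay
  refine ⟨max C 0, le_max_right _ _, fun H hH β hβ x y μ ν μ' ν' e e' i i' he he' c c' => ?_⟩
  have h := hC H hH β hβ (e, c) (e', c')
  have hβ' : 0 ≤ (2 * β)⁻¹ := by positivity
  have hlog : 0 ≤ 1 + Real.log H := by
    have : (1 : ℝ) ≤ H := by exact_mod_cast hH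
    linarith [Real.log_nonneg this]
  have hd0 : 0 ≤ siteDist e.1.1.1 e'.1.1.1 := GhostKernel.siteDist_nonneg _ _
  -- the distance in ✓S3b is `siteDist e.site e'.site`
  have h1 : |(2 * β)⁻¹ * (if c = c' then (hodgeQ H)⁻¹ e e' else 0)| ≤
      (2 * β)⁻¹ * (max C 0 * (1 + Real.log H) / (1 + siteDist e.1.1.1 e'.1.1.1) ^ 2) := by
    refine h.trans (mul_le_mul_of_nonneg_left ?_ hβ')
    exact div_le_div_of_nonneg_right (mul_le_mul_of_nonneg_right (le_max_left _ _) hlog) (by positivity)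
  refine h1.trans (mul_le_mul_of_nonneg_left ?_ hβ')
  have hx : ∀ k, |((e.1.1.1 k - x k : ℤ) : ℝ)| ≤ 1 := fun k => by rw [he]; exact plaqEdge_fst_sub_le x μ ν i k
  have hy : ∀ k, |((e'.1.1.1 k - y k : ℤ) : ℝ)| ≤ 1 := fun k => by rw [he']; exact plaqEdge_fst_sub_le y μ' ν' i' k
  have hgeo := inv_sq_one_add_siteDist_le x y _ _ hx hy
  rw [siteDist_comm x y] at hgeo
  have hK : 0 ≤ max C 0 * (1 + Real.log H) := mul_nonneg (le_max_right _ _) hlog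
  calc max C 0 * (1 + Real.log H) / (1 + siteDist e.1.1.1 e'.1.1.1) ^ 2
        = max C 0 * (1 + Real.log H) * (1 / (1 + siteDist e.1.1.1 e'.1.1.1) ^ 2) := by ring
    _ ≤ max C 0 * (1 + Real.log H) * (9 / (1 + siteDist y x) ^ 2) := mul_le_mul_of_nonneg_left hgeo hK
    _ = 9 * max C 0 * (1 + Real.log H) / (1 + siteDist y x) ^ 2 := by ring

/-! ## §3 The per-pair triple bond -/

/-- ★ Per-pair triple bond: for `H ≥ 1`, `β > 0`, `|T|, |T'| ≤ B` and plaquettes `p`, `p'`,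
`|∫ tripleForm T (plaqVar_p a) · tripleForm T' (plaqVar_{p'} a) · e^{−βQ} da| ≤ Z · 15·((2β)⁻¹·9C(1+log H)/(1+d(p'.1,p.1))²)³ · (384B)²`. -/
theorem abs_integral_plaqPair_le : ∃ C : ℝ, 0 ≤ C ∧ ∀ H : ℕ, 1 ≤ H → ∀ β : ℝ, 0 < β → ∀ B : ℝ,
    ∀ (T T' : Fin 4 → Fin 4 → Fin 4 → ℝ), (∀ i j k, |T i j k| ≤ B) → (∀ i j k, |T' i j k| ≤ B) →
    ∀ p p' : ZdPlaquette 4,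
      |∫ a : LandauFree H → E3, tripleForm T (plaqVar H p.1 p.2.1.1 p.2.1.2 a) * tripleForm T' (plaqVar H p'.1 p'.2.1.1 p'.2.1.2 a) *
          Real.exp (-(β * ∑ c : Fin 3, (fun e => a e c) ⬝ᵥ (hodgeQ H *ᵥ fun e => a e c)))| ≤
        Real.sqrt (Real.pi / β) ^ Fintype.card (LandauFree H × Fin 3) / Real.sqrt (hodgeQ H ⊗ₖ (1 : Matrix (Fin 3) (Fin 3) ℝ)).det *
          (15 * ((2 * β)⁻¹ * (9 * C * (1 + Real.log H) / (1 + siteDist p'.1 p.1) ^ 2)) ^ 3) * (384 * B) ^ 2 := by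
  obtain ⟨C, hC0, hC⟩ := cross_propagator_le
  refine ⟨C, hC0, fun H hH β hβ B T T' hT hT' p p' => ?_⟩
  have hlog : 0 ≤ 1 + Real.log H := by
    have : (1 : ℝ) ≤ H := by exact_mod_cast hH
    linarith [Real.log_nonneg this]
  have hM : 0 ≤ (2 * β)⁻¹ * (9 * C * (1 + Real.log H) / (1 + siteDist p'.1 p.1) ^ 2) := by
    have := GhostKernel.siteDist_nonneg p'.1 p.1
    positivity
  exact abs_integral_tripleForm_mul_tripleForm_le H hβ p.1 p'.1 _ _ _ _ T T' hT hT' hM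
    fun e e' i i' he he' c c' => hC H hH β hβ p.1 p'.1 _ _ _ _ e e' i i' he he' c c'

/-! ## §4 Counting -/

/-- ★ Shell sum over ANY finite set of plaquettes: `Σ_{p'∈S} (1 + d(p'.1, x))⁻⁶ ≤ 2048` (fibres of ✓`CubeShell.card_fibre_le`, `≤ 16` planes per site). -/
theorem sum_plaquettes_inv_pow_six_le (S : Finset (ZdPlaquette 4)) (x : Site 4) :
    ∑ p' ∈ S, 1 / (1 + siteDist p'.1 x) ^ 6 ≤ 2048 := by
  classical
  set f : ZdPlaquette 4 → ℕ := fun p' => Literature.MathematicalPhysics.QuantumFieldTheory.Balaban1983to89.Beta.PoissonInterior.supNorm (p'.1 - x)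
    with hf
  set K := S.sup f with hK
  have hmaps : ∀ p' ∈ S, f p' ∈ Finset.range (K + 1) := fun p' hp' =>
    Finset.mem_range.2 (Nat.lt_succ_of_le (Finset.le_sup (f := f) hp'))
  rw [← Finset.sum_fiberwise_of_maps_to hmaps]
  -- each fibre: `#fibre_k · (1+k)⁻⁶ ≤ 16·64(k+1)³·(k+1)⁻⁶ ≤ 1024/(k+1)²`
  have hfib : ∀ k ∈ Finset.range (K + 1), ∑ p' ∈ S.filter (fun p' => f p' = k), 1 / (1 + siteDist p'.1 x) ^ 6 ≤ 1024 / ((k : ℝ) + 1) ^ 2 := by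
    intro k _
    have hval : ∀ p' ∈ S.filter (fun p' => f p' = k), 1 / (1 + siteDist p'.1 x) ^ 6 = 1 / ((k : ℝ) + 1) ^ 6 := by
      intro p' hp'
      rw [Finset.mem_filter] at hp'
      rw [CubeShell.siteDist_eq_supNorm, show Literature.MathematicalPhysics.QuantumFieldTheory.Balaban1983to89.Beta.PoissonInterior.supNorm
        (p'.1 - x) = k from hp'.2, add_comm]
    rw [Finset.sum_congr rfl hval, Finset.sum_const, nsmul_eq_mul]
    -- the fibre injects into (site fibre) × (planes)
    have hcard : ((S.filter fun p' => f p' = k).card : ℝ) ≤ 16 * (64 * ((k : ℝ) + 1) ^ 3) := by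
      have hsub : S.filter (fun p' => f p' = k) ⊆
          ((S.image Prod.fst).filter fun y => Literature.MathematicalPhysics.QuantumFieldTheory.Balaban1983to89.Beta.PoissonInterior.supNorm
            (y - x) = k) ×ˢ (Finset.univ : Finset {q : Fin 4 × Fin 4 // q.1 < q.2}) := by
        intro p' hp'
        rw [Finset.mem_filter] at hp'
        rw [Finset.mem_product, Finset.mem_filter]
        exact ⟨⟨Finset.mem_image_of_mem _ hp'.1, hp'.2⟩, Finset.mem_univ _⟩
      have h1 := Finset.card_le_card hsub
      rw [Finset.card_product, Finset.card_univ] at h1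
      have h2 := CubeShell.card_fibre_le (S.image Prod.fst) x k
      have h3 : Fintype.card {q : Fin 4 × Fin 4 // q.1 < q.2} ≤ 16 := (Fintype.card_subtype_le _).trans (by simp)
      calc ((S.filter fun p' => f p' = k).card : ℝ)
          ≤ (((S.image Prod.fst).filter fun y => Literature.MathematicalPhysics.QuantumFieldTheory.Balaban1983to89.Beta.PoissonInterior.supNorm
              (y - x) = k).card : ℝ) * Fintype.card {q : Fin 4 × Fin 4 // q.1 < q.2} := by exact_mod_cast h1
        _ ≤ (64 * ((k : ℝ) + 1) ^ 3) * 16 := mul_le_mul h2 (by exact_mod_cast h3) (by positivity) (by positivity)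
        _ = 16 * (64 * ((k : ℝ) + 1) ^ 3) := by ring
    have hk0 : (0 : ℝ) < (k : ℝ) + 1 := by positivity
    calc ((S.filter fun p' => f p' = k).card : ℝ) * (1 / ((k : ℝ) + 1) ^ 6)
        ≤ 16 * (64 * ((k : ℝ) + 1) ^ 3) * (1 / ((k : ℝ) + 1) ^ 6) := mul_le_mul_of_nonneg_right hcard (by positivity)
      _ = 1024 / ((k : ℝ) + 1) ^ 2 * (1 / ((k : ℝ) + 1)) := by field_simp; ring
      _ ≤ 1024 / ((k : ℝ) + 1) ^ 2 * 1 := by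
          refine mul_le_mul_of_nonneg_left ?_ (by positivity)
          rw [div_le_one hk0]; linarith [show (0 : ℝ) ≤ k from Nat.cast_nonneg k]
      _ = 1024 / ((k : ℝ) + 1) ^ 2 := mul_one _
  refine (Finset.sum_le_sum hfib).trans ?_
  -- `Σ_{k ≤ K} 1024/(k+1)² ≤ 1024·(1 + 1)`
  rw [Finset.range_eq_Ico, Finset.sum_eq_sum_Ico_succ_bot (Nat.succ_pos K)]
  have htail := CubeShell.sum_Ico_inv_sq_le 0 (K + 1)
  have htail' : ∑ k ∈ Finset.Ico (0 + 1) (K + 1), 1024 / ((k : ℝ) + 1) ^ 2 ≤ 1024 := by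
    rw [show (∑ k ∈ Finset.Ico (0 + 1) (K + 1), 1024 / ((k : ℝ) + 1) ^ 2) =
      1024 * ∑ k ∈ Finset.Ico (0 + 1) (K + 1), 1 / ((k : ℝ) + 1) ^ 2 by rw [Finset.mul_sum]; exact Finset.sum_congr rfl fun k _ => by ring]
    have : ∑ k ∈ Finset.Ico (0 + 1) (K + 1), 1 / ((k : ℝ) + 1) ^ 2 ≤ 1 := htail.trans (by norm_num)
    linarith
  norm_num at htail' ⊢
  linarith

/-- `#plaquettesTouching(boxEdges 4 (2H+1)) ≤ 16·(2H+2)⁴` (base points in `[−1, 2H]⁴` by ✓`base_bounds_of_mem_plaquettesTouching`, `≤ 16` planes). -/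
theorem card_plaquettesTouching_le (H : ℕ) :
    ((plaquettesTouching (Literature.MathematicalPhysics.QuantumFieldTheory.AxialGauge.boxEdges 4 (2 * H + 1))).card : ℝ) ≤
      16 * (2 * (H : ℝ) + 2) ^ 4 := by
  classical
  have hsub : plaquettesTouching (Literature.MathematicalPhysics.QuantumFieldTheory.AxialGauge.boxEdges 4 (2 * H + 1)) ⊆
      (Fintype.piFinset fun _ : Fin 4 => Finset.Icc (-1 : ℤ) (2 * (H : ℤ))) ×ˢ (Finset.univ : Finset {q : Fin 4 × Fin 4 // q.1 < q.2}) := by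
    intro p hp
    rw [Finset.mem_product, Fintype.mem_piFinset]
    exact ⟨fun k => Finset.mem_Icc.2 (base_bounds_of_mem_plaquettesTouching hp k), Finset.mem_univ _⟩
  have h1 := Finset.card_le_card hsub
  rw [Finset.card_product, Fintype.card_piFinset, Finset.prod_const, Finset.card_univ, Fintype.card_fin, Int.card_Icc,
    Finset.card_univ] at h1
  have h3 : Fintype.card {q : Fin 4 × Fin 4 // q.1 < q.2} ≤ 16 := (Fintype.card_subtype_le _).trans (by simp)
  have h4 : (2 * (H : ℤ) + 1 - -1).toNat = 2 * H + 2 := by omega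
  rw [h4] at h1
  calc ((plaquettesTouching (Literature.MathematicalPhysics.QuantumFieldTheory.AxialGauge.boxEdges 4 (2 * H + 1))).card : ℝ)
      ≤ (((2 * H + 2) ^ 4 * Fintype.card {q : Fin 4 × Fin 4 // q.1 < q.2} : ℕ) : ℝ) := by exact_mod_cast h1
    _ ≤ (((2 * H + 2) ^ 4 * 16 : ℕ) : ℝ) := by exact_mod_cast Nat.mul_le_mul_left _ h3
    _ = 16 * (2 * (H : ℝ) + 2) ^ 4 := by push_cast; ring

/-! ## §5 The triple-bond estimate for the Gaussian average -/

/-- `gaussWeight` in the letters of the Wick engine (definitional). -/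
theorem gaussWeight_eq (β : ℝ) (H : ℕ) (a : LandauFree H → E3) :
    gaussWeight β H a = Real.exp (-(β * ∑ c : Fin 3, (fun e => a e c) ⬝ᵥ (hodgeQ H *ᵥ fun e => a e c))) := rfl

/-- A product of two triple-product vertices times the Gaussian weight is integrable. -/
theorem integrable_tripleForm_mul_tripleForm (H : ℕ) {β : ℝ} (hβ : 0 < β) (x y : Site 4) (μ ν μ' ν' : Fin 4)
    (T T' : Fin 4 → Fin 4 → Fin 4 → ℝ) {B : ℝ} (hT : ∀ i j k, |T i j k| ≤ B) (hT' : ∀ i j k, |T' i j k| ≤ B) :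
    Integrable (fun a : LandauFree H → E3 => tripleForm T (plaqVar H x μ ν a) * tripleForm T' (plaqVar H y μ' ν' a) *
      Real.exp (-(β * ∑ c : Fin 3, (fun e => a e c) ⬝ᵥ (hodgeQ H *ᵥ fun e => a e c)))) := by
  classical
  obtain ⟨K, _, cA, leg, -, -, -, hexpA⟩ := tripleForm_plaqVar_expansion H x μ ν T hT
  obtain ⟨K', _, cB, leg', -, -, -, hexpB⟩ := tripleForm_plaqVar_expansion H y μ' ν' T' hT'
  have hfun : (fun a : LandauFree H → E3 => tripleForm T (plaqVar H x μ ν a) * tripleForm T' (plaqVar H y μ' ν' a) *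
      Real.exp (-(β * ∑ c : Fin 3, (fun e => a e c) ⬝ᵥ (hodgeQ H *ᵥ fun e => a e c)))) =
      fun a => ∑ k, ∑ l, cA k * cB l * ((∏ s : Fin 3 ⊕ Fin 3, a ((Sum.elim (leg k) (leg' l)) s).1 ((Sum.elim (leg k) (leg' l)) s).2) *
        Real.exp (-(β * ∑ c : Fin 3, (fun e => a e c) ⬝ᵥ (hodgeQ H *ᵥ fun e => a e c)))) := by
    funext a
    rw [hexpA, hexpB, Finset.sum_mul_sum, Finset.sum_mul]
    refine Finset.sum_congr rfl fun k _ => ?_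
    rw [Finset.sum_mul]
    refine Finset.sum_congr rfl fun l _ => ?_
    rw [← prodCoord_mul_prodCoord]
    ring
  rw [hfun]
  exact integrable_finsetSum _ fun k _ => integrable_finsetSum _ fun l _ =>
    (integrable_prodCoord_mul_exp_colourForm (hodgeQ H) (hodgeQ_posDef H) hβ Finset.univ _).const_mul _

/-- ★★ **The triple-bond estimate.**  There is `C` (depending only on ✓S3b's constant) such that for all `H ≥ 1`, `β > 0`, `B`, and coefficient families
`|T_p ijk| ≤ B` indexed by the plaquettes:
`E₀[(β · Σ_{p touching the box} tripleForm (T p) (plaqVar_p a))²] ≤ C · B² · H⁴ · (1 + log H)³ / β`. -/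
theorem tripleBond_gaussAvg_le : ∃ C : ℝ, ∀ H : ℕ, 1 ≤ H → ∀ β : ℝ, 0 < β → ∀ B : ℝ,
    ∀ T : ZdPlaquette 4 → Fin 4 → Fin 4 → Fin 4 → ℝ, (∀ p i j k, |T p i j k| ≤ B) →
    gaussAvg β H (fun a => (β * ∑ p ∈ plaquettesTouching (Literature.MathematicalPhysics.QuantumFieldTheory.AxialGauge.boxEdges 4 (2 * H + 1)),
        tripleForm (T p) (plaqVar H p.1 p.2.1.1 p.2.1.2 a)) ^ 2) ≤
      C * B ^ 2 * (H : ℝ) ^ 4 * (1 + Real.log H) ^ 3 / β := by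
  classical
  obtain ⟨C, hC0, hpair⟩ := abs_integral_plaqPair_le
  refine ⟨15 * 384 ^ 2 * 9 ^ 3 * 2048 * 16 * 256 / 8 * C ^ 3, fun H hH β hβ B T hT => ?_⟩
  set PT := plaquettesTouching (Literature.MathematicalPhysics.QuantumFieldTheory.AxialGauge.boxEdges 4 (2 * H + 1)) with hPT
  set L := 1 + Real.log H with hL
  have hlog : 0 ≤ L := by
    have : (1 : ℝ) ≤ H := by exact_mod_cast hH
    have := Real.log_nonneg this; rw [hL]; linarith
  have hB : 0 ≤ B := (abs_nonneg _).trans (hT (((0 : Site 4), ⟨(0, 1), by decide⟩) : ZdPlaquette 4) 0 0 0)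
  -- the per-pair constant `Φ/(1+d)^6` (all sign facts BEFORE the integral enters the context)
  obtain ⟨Φ, hΦ⟩ : ∃ Φ : ℝ, 15 * (384 * B) ^ 2 * ((2 * β)⁻¹) ^ 3 * (9 * C * L) ^ 3 = Φ := ⟨_, rfl⟩
  have hΦ0 : 0 ≤ Φ := by rw [← hΦ]; positivity
  have hβ0 : β ≠ 0 := hβ.ne'
  have hH4 : (2 * (H : ℝ) + 2) ^ 4 ≤ 256 * (H : ℝ) ^ 4 := by
    have h1 : (2 * (H : ℝ) + 2) ≤ 4 * H := by
      have : (1 : ℝ) ≤ H := by exact_mod_cast hH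
      linarith
    have h0 : 0 ≤ 2 * (H : ℝ) + 2 := by positivity
    calc (2 * (H : ℝ) + 2) ^ 4 ≤ (4 * (H : ℝ)) ^ 4 := pow_le_pow_left₀ h0 h1 4
      _ = 256 * (H : ℝ) ^ 4 := by ring
  have hpref : 0 ≤ (15 * 384 ^ 2 * 9 ^ 3 * 2048 * 16 / 8 * C ^ 3) * B ^ 2 * L ^ 3 / β := by positivity
  have hβ2 : 0 ≤ β ^ 2 := sq_nonneg β
  obtain ⟨Z, hZdef⟩ : ∃ Z : ℝ, (∫ a : LandauFree H → EuclideanSpace ℝ (Fin 3),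
      Real.exp (-(β * ∑ c : Fin 3, (fun e => a e c) ⬝ᵥ (hodgeQ H *ᵥ fun e => a e c)))) = Z := ⟨_, rfl⟩
  have hZ : 0 < Z := by
    rw [← hZdef]; exact integral_exp_neg_colourForm_pos (hodgeQ H) (hodgeQ_posDef H) hβ (I := LandauFree H)
  have hZ' : Real.sqrt (Real.pi / β) ^ Fintype.card (LandauFree H × Fin 3) /
      Real.sqrt (hodgeQ H ⊗ₖ (1 : Matrix (Fin 3) (Fin 3) ℝ)).det = Z := by
    rw [← hZdef, integral_exp_neg_colourForm (hodgeQ H) (hodgeQ_posDef H) hβ]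
  have hpair' : ∀ p p' : ZdPlaquette 4,
      |∫ a : LandauFree H → E3, tripleForm (T p) (plaqVar H p.1 p.2.1.1 p.2.1.2 a) * tripleForm (T p') (plaqVar H p'.1 p'.2.1.1 p'.2.1.2 a) *
          Real.exp (-(β * ∑ c : Fin 3, (fun e => a e c) ⬝ᵥ (hodgeQ H *ᵥ fun e => a e c)))| ≤
        Z * (Φ * (1 / (1 + siteDist p'.1 p.1) ^ 6)) := by
    intro p p'
    have h := hpair H hH β hβ B (T p) (T p') (hT p) (hT p') p p'
    rw [hZ'] at h
    refine h.trans (le_of_eq ?_)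
    have hd : (1 + siteDist p'.1 p.1) ≠ 0 := ne_of_gt (add_pos_of_pos_of_nonneg one_pos (GhostKernel.siteDist_nonneg p'.1 p.1))
    rw [← hΦ]
    field_simp
    ring
  -- pointwise expansion of the square and integration term by term
  have hsq : ∀ a : LandauFree H → E3,
      (β * ∑ p ∈ PT, tripleForm (T p) (plaqVar H p.1 p.2.1.1 p.2.1.2 a)) ^ 2 * gaussWeight β H a =
        β ^ 2 * ∑ p ∈ PT, ∑ p' ∈ PT, tripleForm (T p) (plaqVar H p.1 p.2.1.1 p.2.1.2 a) * tripleForm (T p') (plaqVar H p'.1 p'.2.1.1 p'.2.1.2 a) *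
          Real.exp (-(β * ∑ c : Fin 3, (fun e => a e c) ⬝ᵥ (hodgeQ H *ᵥ fun e => a e c))) := by
    intro a
    rw [gaussWeight_eq, mul_pow, pow_two (∑ p ∈ PT, tripleForm (T p) (plaqVar H p.1 p.2.1.1 p.2.1.2 a)), Finset.sum_mul_sum, mul_assoc,
      Finset.sum_mul]
    congr 1
    refine Finset.sum_congr rfl fun p _ => ?_
    rw [Finset.sum_mul]
  have hint : ∫ a : LandauFree H → E3, (β * ∑ p ∈ PT, tripleForm (T p) (plaqVar H p.1 p.2.1.1 p.2.1.2 a)) ^ 2 * gaussWeight β H a =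
      β ^ 2 * ∑ p ∈ PT, ∑ p' ∈ PT, ∫ a : LandauFree H → E3,
        tripleForm (T p) (plaqVar H p.1 p.2.1.1 p.2.1.2 a) * tripleForm (T p') (plaqVar H p'.1 p'.2.1.1 p'.2.1.2 a) *
          Real.exp (-(β * ∑ c : Fin 3, (fun e => a e c) ⬝ᵥ (hodgeQ H *ᵥ fun e => a e c))) := by
    simp_rw [hsq]
    rw [integral_const_mul, integral_finsetSum _ fun p _ => integrable_finsetSum _ fun p' _ =>
      integrable_tripleForm_mul_tripleForm H hβ _ _ _ _ _ _ (T p) (T p') (hT p) (hT p')]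
    congr 1
    refine Finset.sum_congr rfl fun p _ => ?_
    rw [integral_finsetSum _ fun p' _ => integrable_tripleForm_mul_tripleForm H hβ _ _ _ _ _ _ (T p) (T p') (hT p) (hT p')]
  -- the double sum of pair bounds
  have hsum : ∑ p ∈ PT, ∑ p' ∈ PT, |∫ a : LandauFree H → E3,
        tripleForm (T p) (plaqVar H p.1 p.2.1.1 p.2.1.2 a) * tripleForm (T p') (plaqVar H p'.1 p'.2.1.1 p'.2.1.2 a) *
          Real.exp (-(β * ∑ c : Fin 3, (fun e => a e c) ⬝ᵥ (hodgeQ H *ᵥ fun e => a e c)))| ≤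
      Z * Φ * (2048 * (16 * (2 * (H : ℝ) + 2) ^ 4)) := by
    calc _ ≤ ∑ p ∈ PT, ∑ p' ∈ PT, Z * (Φ * (1 / (1 + siteDist p'.1 p.1) ^ 6)) :=
          Finset.sum_le_sum fun p _ => Finset.sum_le_sum fun p' _ => hpair' p p'
      _ = Z * Φ * ∑ p ∈ PT, ∑ p' ∈ PT, 1 / (1 + siteDist p'.1 p.1) ^ 6 := by
          rw [Finset.mul_sum]
          refine Finset.sum_congr rfl fun p _ => ?_
          rw [Finset.mul_sum]
          refine Finset.sum_congr rfl fun p' _ => ?_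
          ring
      _ ≤ Z * Φ * ∑ _p ∈ PT, (2048 : ℝ) := by
          refine mul_le_mul_of_nonneg_left (Finset.sum_le_sum fun p _ => sum_plaquettes_inv_pow_six_le PT p.1) ?_
          exact mul_nonneg hZ.le hΦ0
      _ ≤ Z * Φ * (2048 * (16 * (2 * (H : ℝ) + 2) ^ 4)) := by
          rw [Finset.sum_const, nsmul_eq_mul]
          refine mul_le_mul_of_nonneg_left ?_ (mul_nonneg hZ.le hΦ0)
          rw [mul_comm]
          exact mul_le_mul_of_nonneg_left (card_plaquettesTouching_le H) (by norm_num)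
  -- assemble
  have hden : (∫ a : LandauFree H → E3, gaussWeight β H a) = Z := by
    rw [← hZdef]; rfl
  unfold gaussAvg
  rw [hden, div_le_iff₀ hZ, hint]
  calc β ^ 2 * ∑ p ∈ PT, ∑ p' ∈ PT, ∫ a : LandauFree H → E3,
          tripleForm (T p) (plaqVar H p.1 p.2.1.1 p.2.1.2 a) * tripleForm (T p') (plaqVar H p'.1 p'.2.1.1 p'.2.1.2 a) *
            Real.exp (-(β * ∑ c : Fin 3, (fun e => a e c) ⬝ᵥ (hodgeQ H *ᵥ fun e => a e c)))
        ≤ β ^ 2 * ∑ p ∈ PT, ∑ p' ∈ PT, |∫ a : LandauFree H → E3,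
          tripleForm (T p) (plaqVar H p.1 p.2.1.1 p.2.1.2 a) * tripleForm (T p') (plaqVar H p'.1 p'.2.1.1 p'.2.1.2 a) *
            Real.exp (-(β * ∑ c : Fin 3, (fun e => a e c) ⬝ᵥ (hodgeQ H *ᵥ fun e => a e c)))| :=
          mul_le_mul_of_nonneg_left (Finset.sum_le_sum fun p _ => Finset.sum_le_sum fun p' _ => le_abs_self _) hβ2
    _ ≤ β ^ 2 * (Z * Φ * (2048 * (16 * (2 * (H : ℝ) + 2) ^ 4))) := mul_le_mul_of_nonneg_left hsum hβ2
    _ = Z * (15 * 384 ^ 2 * 9 ^ 3 * 2048 * 16 / 8 * C ^ 3) * B ^ 2 * L ^ 3 / β * (2 * (H : ℝ) + 2) ^ 4 := by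
          rw [← hΦ]
          field_simp
          ring
    _ ≤ Z * (15 * 384 ^ 2 * 9 ^ 3 * 2048 * 16 / 8 * C ^ 3) * B ^ 2 * L ^ 3 / β * (256 * (H : ℝ) ^ 4) := by
          refine mul_le_mul_of_nonneg_left hH4 ?_
          have : Z * (15 * 384 ^ 2 * 9 ^ 3 * 2048 * 16 / 8 * C ^ 3) * B ^ 2 * L ^ 3 / β =
            Z * ((15 * 384 ^ 2 * 9 ^ 3 * 2048 * 16 / 8 * C ^ 3) * B ^ 2 * L ^ 3 / β) := by ring
          rw [this]; exact mul_nonneg hZ.le hpref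
    _ = 15 * 384 ^ 2 * 9 ^ 3 * 2048 * 16 * 256 / 8 * C ^ 3 * B ^ 2 * (H : ℝ) ^ 4 * L ^ 3 / β * Z := by ring

end EdgeChartGaussian

end Summit.QuantumFields.YangMills.Theorems.AllWindowsColdBoxBoxHighLine

end
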